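import Literature.MathematicalPhysics.QuantumFieldTheory.Balaban1983to89.B8Eq148Local

/-!
# `Balaban1983to89.B8Eq154Local` — [Balaban1985RegularSpaces] (1.51), (1.53), (1.54) p. 85 «on Ω_j»: the basic estimate
# (1.54) AT ONE BOND from hypotheses on the plaquettes through that bond only

statement-level skeleton of published theorems with citation tags; proofs where landed; nothing here is a claim about the Yang–Mills mass gap

T. Bałaban, *Spaces of regular gauge field configurations on a lattice and gauge fixing conditions*, Commun.
Math. Phys. **99** (1985) 75–102 `[Balaban1985RegularSpaces]` ("B8"; printed page = PDF page + 74).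
PDF held: `paper:balaban1985-cmp99-regular-spaces-gauge-fixing` (lit store), pp. 76–77, 84–86 and 100 read as text
(`p0002.txt`, `p0003.txt`, `p0010.txt`–`p0012.txt`, `p0026.txt`).  STATUS: published, refereed.
This file RE-DERIVES the parents' kernel certificates of (1.51)–(1.54) (`B8Eq151V2Divergence.eq151`, `eq153`,
`norm_main146_le`, `eq154`, `eq154_printed`) — whose smallness hypotheses are quantified over ALL bonds / plaquettes
of `ℤ^d` — with the SAME proofs but with the hypotheses restricted to the plaquettes having the bond as a side, the
sides of those plaquettes and the gradient entries based at those sides (`B8Eq140Level.PlaqNear`/`BondNear`), which is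
what the printed argument uses ((1.54) «on Ω_j», p. 85).  Nothing here is new mathematics and nothing here is a claim
about the Clay problem.  Companions: `B8Eq148Local` ((1.44), (1.46), (1.48) local), `B8Prop7ClassAkLocal`.

WHAT IS REPRODUCED (lit-balaban SKELETON rows): **B8.Eq1.51**, **B8.Eq1.54** (with (1.52), (1.53)) in their printed
LOCAL form — the input of **B8.Eq1.141-1.143** (1.142) and **B8.Prop7**.  Unit `lit-balaban-p40` (Phase-2 proof seat
p40, gen 5), HOME `run/shared/lean/pub/lit-balaban/` (owner fold `lit-balaban-r05/ROWS-B8.md`).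

## THE PRINTED TEXT (p. 85 [PDF 11], quoted from the text layer)

«Thus D^{η*}_{U₀}V₂(U₀, A) = −2Σ_{ν=1}^{d} D^{η*}_ν[A_μ, A_ν] + O₁(48d|A||∇^η_{U₀}A|). (1.51)  Further
(D*[A_μ, A_ν])(x) = η[(D*A_μ)(x), (D*A_ν)(x)] + [(D*A_μ)(x), A_ν(x)] + [A_μ(x), (D*A_ν)(x)], (1.52) hence, taking into
account the identity (D*_μA)(x) = −R(U₀(x − ηe_μ, x))(D_μA)(x − ηe_μ), we get
|½η²D^{η*}_{U₀}V₂(U₀, A)| = O₁(32d|A||∇^η_{U₀}A|η²) = O₁(32dα₂(Lʲη)⁻¹|∇^η_{U₀}A|η²). (1.53)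
Gathering together the equalities and the estimates obtained until now we get
D^{η*}_{U₁U₀}∂U₁U₀ = D^{η*}_{U₀}∂U₀ + iη²D^{η*}_{U₀}D^η_{U₀}A + O₁(36dα₂(Lʲη)⁻¹|∇^η_{U₀}A|η²) + O₁(50dα₂³(Lʲη)⁻³η²)
+ O₁(10dα₀α₂(Lʲη)⁻³η²) on Ω_j. (1.54)»

## WHAT IS CERTIFIED HERE (kernel; axioms `propext` / `Classical.choice` / `Quot.sound`)

For the bond `b = ⟨x, x + e_μ⟩` of `ℤ^d` (carriers and conventions as in `B8Eq148Local`):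
* §1 **(1.51)/(1.53) AT ONE BOND** and the main term of (1.46): `eq151_loc` (`48(d − 1)aG`), `norm_covDeriv_adR_le_loc`
  ((1.52) ⇒ `8aG`), `norm_pdiv_brk0_le_loc`, `eq153_loc` (`64(d − 1)aG`), `eq153_quad_loc`, `eq153_printed_loc`
  (`32d·α·G·η²`), `norm_main146_le_loc` (`4(d − 1)aG`) — for `|B| ≤ a` on the `BondNear` bonds and `|(D_κB_τ)(y)| ≤ G`
  for the gradient entries whose base bond `⟨y, y + e_τ⟩` is `BondNear`.
* §2 **(1.54) AT ONE BOND**: `eq154_loc` (sharp, general exponent field) and **`eq154_printed_loc`** — the parent's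
  `eq154_printed` VERBATIM IN ITS CONCLUSION (`36d`, `50d`, `10d`) with every smallness hypothesis restricted to the
  `PlaqNear` plaquettes / `BondNear` bonds / `BondNear`-based gradient entries of the bond.

## HONEST SCOPE — what is NOT claimed

(i) Estimates, constants and side conditions are EXACTLY the parent's (`16a ≤ 1 ∧ 5a(d − 1) ≤ 4` for `50d`,
`a = α₂(Lʲη)⁻¹η`); only the quantifiers of the hypotheses shrink.  (ii) The gradient entries include the diagonal
ones `(D_νA_ν)(x − e_ν)` entering through (1.52), as in print's `|∇^η_{U₀}A|`.  (iii) `0 ≤ G` (and `0 ≤ α`) are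
explicit hypotheses of the printed-unit forms (for `d = 1` the gradient hypotheses are vacuous).  (iv) «on Ω_j»: see
`B8Prop7ClassAkLocal` / `B8Eq140Level` HONEST SCOPE (i).
-/

noncomputable section

open scoped BigOperators
open NormedSpace Finset

namespace Literature.MathematicalPhysics.QuantumFieldTheory.Balaban1983to89.B8Eq154Local

open B7Prop1Explicit
open B7Eq78Linearization (conjR conjR_apply conjR_one conjR_add conjR_sub conjR_smul conjR_smul_real)
open B8Lemma1NonAbelian (mulCfg)
open B8Ineq132 (plaqF covDeriv covDerivFwd covDiv conjR_conjR one_conjR conjR_sum conjR_units norm_conjR_le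
  norm_conjR)
open B8Eq143PlaqExpansion
open B8Eq146AExpansion
open B8Eq151V2Divergence
open B8Eq140Level
open B8Eq148Local

-- `Site` alone would resolve to the torus sites of `Setup.lean`; re-export the `ℤ^d` sites of `B7Prop1Explicit`.
export B7Prop1Explicit (Site)

variable {d : ℕ}

/-! ## §1 (1.51), (1.53) and the main term of (1.46) at one bond -/

section Eq153

variable {𝔸 : Type*} [NormedRing 𝔸] [NormOneClass 𝔸] [NormedAlgebra ℂ 𝔸]

/-- **(1.51) AT ONE BOND** (sharp form): for `U1`-valued `U₀`, `|B| ≤ a` on the `BondNear` bonds and `|(D_κB_τ)(y)| ≤ G`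
for the gradient entries based at `BondNear` bonds `⟨y, y + e_τ⟩`, `η > 0`:
`|D^{η*}_{U₀}V₂(U₀, B)_μ(x) − D^{η*}_{U₀}(2[B_μ, B_ν])_μ(x)| ≤ 48(d − 1)·a·G`. [cite: Balaban1985RegularSpaces, (1.51) p.85] -/
theorem eq151_loc {η : ℝ} (hη : 0 < η) {U₀ : Site d → Fin d → 𝔸ˣ} (h₀ : ∀ y κ, U₀ y κ ∈ U1 𝔸)
    {B : Site d → Fin d → 𝔸} {a G : ℝ} {μ : Fin d} {x : Site d} (hB : ∀ y τ, BondNear μ x y τ → ‖B y τ‖ ≤ a)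
    (hG : ∀ (y : Site d) (κ τ : Fin d), BondNear μ x y τ → ‖covDerivFwd η U₀ κ (fun w => B w τ) y‖ ≤ G) :
    ‖pdiv η U₀ (V2 U₀ B) μ x - pdiv η U₀ (brk0 B) μ x‖ ≤ 48 * ((d : ℝ) - 1) * a * G := by
  have hsplit : V2 U₀ B = (V2 U₀ B - brk0 B) + brk0 B := (sub_add_cancel _ _).symm
  rw [hsplit, pdiv_add, add_sub_cancel_right]
  have hR : ∀ (κ τ : Fin d) (y : Site d), PlaqNear μ x y κ τ → ‖(V2 U₀ B - brk0 B) κ τ y‖ ≤ 24 * η * a * G := by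
    intro κ τ y hq
    simp only [Pi.sub_apply]
    exact norm_V2_sub_brk0_le_loc hη h₀ (fun w σ hs => hB w σ (bondNear_of hq hs))
      (hG _ _ _ (bondNear_of hq (isSide₄ y κ τ))) (hG _ _ _ (bondNear_of hq (isSide₁ y κ τ)))
  have h1 : η⁻¹ * η = 1 := inv_mul_cancel₀ hη.ne'
  unfold pdiv
  calc _ ≤ ((d : ℝ) - 1) * (η⁻¹ * (24 * η * a * G + 24 * η * a * G)) := by
        refine norm_sub_sums_le (fun ν hν => ?_) (fun ν hν => ?_)
        · have hne : ν ≠ μ := (Finset.mem_Iio.mp hν).ne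
          exact (norm_covDeriv_le hη (h₀ _ _) _).trans
            (mul_le_mul_of_nonneg_left (add_le_add (hR _ _ _ (plaqNear₃ hne)) (hR _ _ _ (plaqNear₁ hne)))
              (inv_nonneg.mpr hη.le))
        · have hne : ν ≠ μ := (Finset.mem_Ioi.mp hν).ne'
          exact (norm_covDeriv_le hη (h₀ _ _) _).trans
            (mul_le_mul_of_nonneg_left (add_le_add (hR _ _ _ (plaqNear₄ hne)) (hR _ _ _ (plaqNear₂ hne)))
              (inv_nonneg.mpr hη.le))
    _ = 48 * ((d : ℝ) - 1) * a * G * (η⁻¹ * η) := by ring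
    _ = 48 * ((d : ℝ) - 1) * a * G := by rw [h1, mul_one]

/-- **(1.52) ⇒** `|(D*_ν[B_μ, B_ν])(x)| ≤ 8·a·G` at one bond (`ν ≠ μ`), with `|B|` on the `BondNear` bonds and the
gradient entries `(D_νB_μ)(x − e_ν)`, `(D_νB_ν)(x − e_ν)` (both based at sides of `p_{νμ}(x − e_ν)`).
[cite: Balaban1985RegularSpaces, (1.52)-(1.53) p.85] -/
theorem norm_covDeriv_adR_le_loc {η : ℝ} (hη : 0 < η) {U₀ : Site d → Fin d → 𝔸ˣ} (h₀ : ∀ y κ, U₀ y κ ∈ U1 𝔸)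
    {B : Site d → Fin d → 𝔸} {a G : ℝ} {μ ν : Fin d} (hνμ : ν ≠ μ) {x : Site d}
    (hB : ∀ y τ, BondNear μ x y τ → ‖B y τ‖ ≤ a)
    (hG : ∀ (y : Site d) (κ τ : Fin d), BondNear μ x y τ → ‖covDerivFwd η U₀ κ (fun w => B w τ) y‖ ≤ G) :
    ‖covDeriv η U₀ ν (fun y => adR (B y μ) (B y ν)) x‖ ≤ 8 * a * G := by
  rw [eq152 hη.ne' U₀ (fun y => B y μ) (fun y => B y ν) ν x, ← adR_smul_left_real]
  have hq₃ : PlaqNear μ x (x - e ν) ν μ := plaqNear₃ hνμ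
  have hq₁ : PlaqNear μ x x ν μ := plaqNear₁ hνμ
  have hDF : ‖covDeriv η U₀ ν (fun y => B y μ) x‖ ≤ G := by
    rw [norm_covDeriv_eq (h₀ _ _)]
    exact hG _ _ _ (bondNear_of hq₃ (isSide₄ _ _ _))
  have hDH : ‖covDeriv η U₀ ν (fun y => B y ν) x‖ ≤ G := by
    rw [norm_covDeriv_eq (h₀ _ _)]
    exact hG _ _ _ (bondNear_of hq₃ (isSide₁ _ _ _))
  have hηDF : ‖η • covDeriv η U₀ ν (fun y => B y μ) x‖ ≤ 2 * a :=
    norm_eta_smul_covDeriv_le_loc hη.ne' h₀ (hB _ _ (bondNear_of hq₃ (isSide₄ _ _ _)))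
      (hB _ _ (bondNear_of hq₁ (isSide₄ _ _ _)))
  calc _ ≤ ‖adR (η • covDeriv η U₀ ν (fun y => B y μ) x) (covDeriv η U₀ ν (fun y => B y ν) x)‖ +
        ‖adR (covDeriv η U₀ ν (fun y => B y μ) x) (B x ν)‖ + ‖adR (B x μ) (covDeriv η U₀ ν (fun y => B y ν) x)‖ :=
        norm_add₃_le
    _ ≤ 2 * (2 * a) * G + 2 * G * a + 2 * a * G :=
        add_le_add (add_le_add (norm_adR_le_of_le hηDF hDH)
          (norm_adR_le_of_le hDF (hB x ν (bondNear_of hq₁ (isSide₁ _ _ _)))))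
          (norm_adR_le_of_le (hB x μ (bondNear_of hq₁ (isSide₄ _ _ _))) hDH)
    _ = 8 * a * G := by ring

/-- `|D^{η*}_{U₀}(2[B_μ, B_ν])_μ(x)| ≤ 16(d − 1)·a·G` at one bond. [cite: Balaban1985RegularSpaces, (1.51)-(1.53) p.85] -/
theorem norm_pdiv_brk0_le_loc {η : ℝ} (hη : 0 < η) {U₀ : Site d → Fin d → 𝔸ˣ} (h₀ : ∀ y κ, U₀ y κ ∈ U1 𝔸)
    {B : Site d → Fin d → 𝔸} {a G : ℝ} {μ : Fin d} {x : Site d} (hB : ∀ y τ, BondNear μ x y τ → ‖B y τ‖ ≤ a)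
    (hG : ∀ (y : Site d) (κ τ : Fin d), BondNear μ x y τ → ‖covDerivFwd η U₀ κ (fun w => B w τ) y‖ ≤ G) :
    ‖pdiv η U₀ (brk0 B) μ x‖ ≤ 16 * ((d : ℝ) - 1) * a * G := by
  rw [pdiv_brk0, norm_neg]
  refine (norm_two_mul_le _).trans ?_
  have hs : ‖∑ ν ∈ Finset.univ.erase μ, covDeriv η U₀ ν (fun y => adR (B y μ) (B y ν)) x‖ ≤
      ((d : ℝ) - 1) * (8 * a * G) := by
    refine (norm_sum_le_of_le _ fun ν hν =>
      norm_covDeriv_adR_le_loc hη h₀ (Finset.ne_of_mem_erase hν) hB hG).trans ?_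
    rw [Finset.sum_const, nsmul_eq_mul, Finset.card_erase_of_mem (Finset.mem_univ μ), Finset.card_univ,
      Fintype.card_fin, Nat.cast_pred (Fin.pos μ)]
  linarith

/-- **(1.53) AT ONE BOND**: `|D^{η*}_{U₀}V₂(U₀, B)_μ(x)| ≤ 64(d − 1)·a·G` (`16 + 48`).
[cite: Balaban1985RegularSpaces, (1.53) p.85] -/
theorem eq153_loc {η : ℝ} (hη : 0 < η) {U₀ : Site d → Fin d → 𝔸ˣ} (h₀ : ∀ y κ, U₀ y κ ∈ U1 𝔸)
    {B : Site d → Fin d → 𝔸} {a G : ℝ} {μ : Fin d} {x : Site d} (hB : ∀ y τ, BondNear μ x y τ → ‖B y τ‖ ≤ a)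
    (hG : ∀ (y : Site d) (κ τ : Fin d), BondNear μ x y τ → ‖covDerivFwd η U₀ κ (fun w => B w τ) y‖ ≤ G) :
    ‖pdiv η U₀ (V2 U₀ B) μ x‖ ≤ 64 * ((d : ℝ) - 1) * a * G := by
  have h1 := eq151_loc hη h₀ hB hG
  have h2 := norm_pdiv_brk0_le_loc hη h₀ hB hG
  calc ‖pdiv η U₀ (V2 U₀ B) μ x‖
      = ‖(pdiv η U₀ (V2 U₀ B) μ x - pdiv η U₀ (brk0 B) μ x) + pdiv η U₀ (brk0 B) μ x‖ := by rw [sub_add_cancel]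
    _ ≤ ‖pdiv η U₀ (V2 U₀ B) μ x - pdiv η U₀ (brk0 B) μ x‖ + ‖pdiv η U₀ (brk0 B) μ x‖ := norm_add_le _ _
    _ ≤ 48 * ((d : ℝ) - 1) * a * G + 16 * ((d : ℝ) - 1) * a * G := add_le_add h1 h2
    _ = 64 * ((d : ℝ) - 1) * a * G := by ring

/-- `|D^{η*}_{U₀}(quad)_μ(x)| ≤ 32(d − 1)·a·G` at one bond (`quad = ½V₂`). [cite: Balaban1985RegularSpaces, (1.53) p.85] -/
theorem eq153_quad_loc {η : ℝ} (hη : 0 < η) {U₀ : Site d → Fin d → 𝔸ˣ} (h₀ : ∀ y κ, U₀ y κ ∈ U1 𝔸)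
    {B : Site d → Fin d → 𝔸} {a G : ℝ} {μ : Fin d} {x : Site d} (hB : ∀ y τ, BondNear μ x y τ → ‖B y τ‖ ≤ a)
    (hG : ∀ (y : Site d) (κ τ : Fin d), BondNear μ x y τ → ‖covDerivFwd η U₀ κ (fun w => B w τ) y‖ ≤ G) :
    ‖pdiv η U₀ (quad U₀ B) μ x‖ ≤ 32 * ((d : ℝ) - 1) * a * G := by
  rw [quad_eq_half_V2, pdiv_smul, norm_smul, norm_inv, Complex.norm_two]
  have h := eq153_loc hη h₀ hB hG
  linarith

/-- **(1.53) WITH PRINT'S `32d` AT ONE BOND**: `|½η²D^{η*}_{U₀}V₂(U₀, A)_μ(x)| ≤ 32d·α·G·η²` for `|A| ≤ α` on the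
`BondNear` bonds and `|∇^η_{U₀}A| ≤ G` at the `BondNear`-based gradient entries (`α, G ≥ 0`).
[cite: Balaban1985RegularSpaces, (1.53) p.85] -/
theorem eq153_printed_loc {η : ℝ} (hη : 0 < η) {U₀ : Site d → Fin d → 𝔸ˣ} (h₀ : ∀ y κ, U₀ y κ ∈ U1 𝔸)
    {A : Site d → Fin d → 𝔸} {α G : ℝ} (hα : 0 ≤ α) (hG0 : 0 ≤ G) {μ : Fin d} {x : Site d}
    (hA : ∀ y τ, BondNear μ x y τ → ‖A y τ‖ ≤ α)
    (hG : ∀ (y : Site d) (κ τ : Fin d), BondNear μ x y τ → ‖covDerivFwd η U₀ κ (fun w => A w τ) y‖ ≤ G) :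
    ‖((η : ℂ) ^ 2 / 2) • pdiv η U₀ (V2 U₀ A) μ x‖ ≤ 32 * d * α * G * η ^ 2 := by
  have hc : ((η : ℂ) ^ 2 / 2) = ((η ^ 2 / 2 : ℝ) : ℂ) := by push_cast; ring
  rw [hc, Complex.coe_smul, norm_smul, Real.norm_of_nonneg (by positivity)]
  have h := eq153_loc hη h₀ hA hG
  have hd1 : (1 : ℝ) ≤ d := Nat.one_le_cast.mpr (Fin.pos μ)
  have h2 : 0 ≤ η ^ 2 / 2 := by positivity
  calc η ^ 2 / 2 * ‖pdiv η U₀ (V2 U₀ A) μ x‖ ≤ η ^ 2 / 2 * (64 * ((d : ℝ) - 1) * α * G) :=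
        mul_le_mul_of_nonneg_left h h2
    _ = 32 * ((d : ℝ) - 1) * α * G * η ^ 2 := by ring
    _ ≤ 32 * d * α * G * η ^ 2 := by
        have : 0 ≤ α * G * η ^ 2 := by positivity
        nlinarith

/-- THE MAIN TERM OF (1.46) AT ONE BOND: `|main146| ≤ 4(d − 1)·a·G` for `|B| ≤ a` on the `BondNear` bonds and
`|∇B| ≤ G` at the `BondNear`-based gradient entries. [cite: Balaban1985RegularSpaces, (1.46), (1.54) pp.84-85] -/
theorem norm_main146_le_loc {η : ℝ} (hη : 0 < η) {U₀ : Site d → Fin d → 𝔸ˣ} (h₀ : ∀ y κ, U₀ y κ ∈ U1 𝔸)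
    {B : Site d → Fin d → 𝔸} {a G : ℝ} {μ : Fin d} {x : Site d} (hB : ∀ y τ, BondNear μ x y τ → ‖B y τ‖ ≤ a)
    (hG : ∀ (y : Site d) (κ τ : Fin d), BondNear μ x y τ → ‖covDerivFwd η U₀ κ (fun w => B w τ) y‖ ≤ G) :
    ‖main146 η U₀ B μ x‖ ≤ 4 * ((d : ℝ) - 1) * a * G := by
  unfold main146
  have h1 : η⁻¹ * η = 1 := inv_mul_cancel₀ hη.ne'
  have key : ∀ ν ∈ Finset.univ.erase μ,
      ‖η⁻¹ • conjR (U₀ (x - e ν) ν)⁻¹ (adR (B (x - e ν) ν) (lin U₀ B μ ν (x - e ν)))‖ ≤ 4 * a * G := by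
    intro ν hν
    have hne : ν ≠ μ := Finset.ne_of_mem_erase hν
    have hq₄ : PlaqNear μ x (x - e ν) μ ν := plaqNear₄ hne
    rw [norm_smul, Real.norm_of_nonneg (inv_nonneg.mpr hη.le)]
    calc η⁻¹ * ‖conjR (U₀ (x - e ν) ν)⁻¹ (adR (B (x - e ν) ν) (lin U₀ B μ ν (x - e ν)))‖
        ≤ η⁻¹ * (2 * a * (2 * η * G)) :=
          mul_le_mul_of_nonneg_left ((norm_conjR_le ((U1 𝔸).inv_mem (h₀ _ _)) _).trans
            (norm_adR_le_of_le (hB _ _ (bondNear_of hq₄ (isSide₄ _ _ _)))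
              (norm_lin_le_deriv_loc hη (hG _ _ _ (bondNear_of hq₄ (isSide₄ _ _ _)))
                (hG _ _ _ (bondNear_of hq₄ (isSide₁ _ _ _)))))) (inv_nonneg.mpr hη.le)
      _ = 4 * a * G * (η⁻¹ * η) := by ring
      _ = 4 * a * G := by rw [h1, mul_one]
  refine (norm_sum_le_of_le _ key).trans ?_
  rw [Finset.sum_const, nsmul_eq_mul, Finset.card_erase_of_mem (Finset.mem_univ μ), Finset.card_univ,
    Fintype.card_fin, Nat.cast_pred (Fin.pos μ)]
  exact le_of_eq (by ring)

end Eq153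

/-! ## §2 (1.54) at one bond -/

section Eq154

variable {𝔸 : Type*} [NormedRing 𝔸] [NormOneClass 𝔸] [NormedAlgebra ℂ 𝔸] [CompleteSpace 𝔸]

/-- **(1.54) AT ONE BOND** (sharp form, general exponent field): for `U1`-valued `U₀` and `U₁ = e^{B}` `U1`-valued,
with `|B| ≤ a`, `|U₁ − 1| ≤ u` on the `BondNear` bonds of `⟨x, x + e_μ⟩`, `|(D_κB_τ)(y)| ≤ G` for the gradient
entries based there, `|U₀(∂p) − 1| ≤ p` on the `PlaqNear` plaquettes, `η > 0`:
`|D^{η*}_{U₁U₀}∂(U₁U₀)_μ(x) − D^{η*}_{U₀}∂U₀,_μ(x) − D^{η*}_{U₀}(Σᵢxᵢ)_μ(x)|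
   ≤ 36(d − 1)aG + (d − 1)η⁻¹Φ(a) + 2(d − 1)η⁻¹ρ₃(4a) + 10(d − 1)η⁻¹up`. [cite: Balaban1985RegularSpaces, (1.54) p.85] -/
theorem eq154_loc {η : ℝ} (hη : 0 < η) {U₀ : Site d → Fin d → 𝔸ˣ} (h₀ : ∀ y κ, U₀ y κ ∈ U1 𝔸)
    {B : Site d → Fin d → 𝔸} (h₁ : ∀ y κ, expCfg B y κ ∈ U1 𝔸) {a G u p : ℝ} {μ : Fin d} {x : Site d}
    (hB : ∀ y τ, BondNear μ x y τ → ‖B y τ‖ ≤ a)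
    (hG : ∀ (y : Site d) (κ τ : Fin d), BondNear μ x y τ → ‖covDerivFwd η U₀ κ (fun z => B z τ) y‖ ≤ G)
    (hu : ∀ y τ, BondNear μ x y τ → ‖(expCfg B y τ : 𝔸) - 1‖ ≤ u)
    (hp : ∀ y κ ν, PlaqNear μ x y κ ν → ‖plaqF U₀ κ ν y - 1‖ ≤ p) :
    ‖covDiv η (mulCfg (expCfg B) U₀) μ x - covDiv η U₀ μ x - pdiv η U₀ (lin U₀ B) μ x‖ ≤
      36 * ((d : ℝ) - 1) * a * G + ((d : ℝ) - 1) * (η⁻¹ * phi146 a) +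
        2 * ((d : ℝ) - 1) * η⁻¹ * expRem3 (4 * a) + 10 * ((d : ℝ) - 1) * η⁻¹ * u * p := by
  set U₁ := expCfg B
  set T0 := covDiv η (mulCfg U₁ U₀) μ x
  set T1 := covDiv η U₀ μ x
  set W := pdiv η (mulCfg U₁ U₀) (covPlaqF U₀ U₁) μ x
  set Y := pdiv η U₀ (covPlaqF U₀ U₁ - 1) μ x
  set M := main146 η U₀ B μ x
  set Lq := pdiv η U₀ (lin U₀ B) μ x
  set Qd := pdiv η U₀ (quad U₀ B) μ x
  have e144 : ‖T0 - T1 - W‖ ≤ 10 * ((d : ℝ) - 1) * η⁻¹ * u * p := eq144_loc hη h₀ h₁ hu hp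
  have e146 : ‖W - Y - M‖ ≤ ((d : ℝ) - 1) * (η⁻¹ * phi146 a) := eq146_loc hη h₀ hB
  have e148 : ‖Y - Lq - Qd‖ ≤ 2 * ((d : ℝ) - 1) * η⁻¹ * expRem3 (4 * a) := eq148_loc hη h₀ hB
  have e153 : ‖Qd‖ ≤ 32 * ((d : ℝ) - 1) * a * G := eq153_quad_loc hη h₀ hB hG
  have eM : ‖M‖ ≤ 4 * ((d : ℝ) - 1) * a * G := norm_main146_le_loc hη h₀ hB hG
  have heq : T0 - T1 - Lq = (T0 - T1 - W) + (W - Y - M) + (Y - Lq - Qd) + Qd + M := by abel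
  rw [heq]
  have n1 := norm_add_le ((T0 - T1 - W) + (W - Y - M) + (Y - Lq - Qd) + Qd) M
  have n2 := norm_add_le ((T0 - T1 - W) + (W - Y - M) + (Y - Lq - Qd)) Qd
  have n3 : ‖(T0 - T1 - W) + (W - Y - M) + (Y - Lq - Qd)‖ ≤ ‖T0 - T1 - W‖ + ‖W - Y - M‖ + ‖Y - Lq - Qd‖ :=
    norm_add₃_le
  linarith

omit [NormOneClass 𝔸] [CompleteSpace 𝔸] in
/-- `|iηX| = η|X|` at one bond value, `η ≥ 0`. [cite: Balaban1985RegularSpaces, (1.41) p.83] -/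
theorem norm_iEta_apply {η : ℝ} (hη : 0 ≤ η) (A : Site d → Fin d → 𝔸) (y : Site d) (κ : Fin d) :
    ‖iEta η A y κ‖ = η * ‖A y κ‖ := by
  show ‖((Complex.I : ℂ) * η) • A y κ‖ = η * ‖A y κ‖
  exact norm_I_eta_smul hη _

/-- **(1.54) AT ONE BOND WITH THE PRINTED CONSTANTS `36d`, `50d`, `10d`** — `B8Eq151V2Divergence.eq154_printed` with
its smallness hypotheses LOCALISED: for `U1`-valued `U₀`, `U₁ = e^{iηA}` `U1`-valued, and, on the `BondNear` bonds
of `b = ⟨x, x + e_μ⟩`, `|U₁ − 1| ≤ α₂(Lʲη)⁻¹η`, `|A| ≤ α₂(Lʲη)⁻¹`; at the gradient entries based there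
`|∇^η_{U₀}A| ≤ G` (`G ≥ 0`); on the `PlaqNear` plaquettes `|U₀(∂p) − 1| ≤ α₀η²(Lʲη)⁻²`; `α₀, α₂ ≥ 0`, `η > 0`,
`16α₂(Lʲη)⁻¹η ≤ 1 ∧ 5α₂(Lʲη)⁻¹η(d − 1) ≤ 4`:
`|D^{η*}_{U₁U₀}∂(U₁U₀)(b) − D^{η*}_{U₀}∂U₀(b) − iη²D^{η*}_{U₀}D^η_{U₀}A(b)|
   ≤ 36dα₂(Lʲη)⁻¹Gη² + 50dα₂³(Lʲη)⁻³η² + 10dα₀α₂(Lʲη)⁻³η²`. [cite: Balaban1985RegularSpaces, (1.54) p.85] -/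
theorem eq154_printed_loc {η : ℝ} (hη : 0 < η) {U₀ : Site d → Fin d → 𝔸ˣ} (h₀ : ∀ y κ, U₀ y κ ∈ U1 𝔸)
    {A : Site d → Fin d → 𝔸} (h₁ : ∀ y κ, expCfg (iEta η A) y κ ∈ U1 𝔸) {L j : ℕ} {α₀ α₂ G : ℝ}
    (hα₀ : 0 ≤ α₀) (hα₂ : 0 ≤ α₂) (hG0 : 0 ≤ G) {μ : Fin d} {x : Site d}
    (hA : ∀ y τ, BondNear μ x y τ → ‖A y τ‖ ≤ α₂ * ((L : ℝ) ^ j * η)⁻¹)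
    (hG : ∀ (y : Site d) (κ τ : Fin d), BondNear μ x y τ → ‖covDerivFwd η U₀ κ (fun z => A z τ) y‖ ≤ G)
    (hu : ∀ y τ, BondNear μ x y τ → ‖(expCfg (iEta η A) y τ : 𝔸) - 1‖ ≤ α₂ * ((L : ℝ) ^ j * η)⁻¹ * η)
    (hp : ∀ y κ ν, PlaqNear μ x y κ ν → ‖plaqF U₀ κ ν y - 1‖ ≤ α₀ * η ^ 2 * (((L : ℝ) ^ j * η)⁻¹) ^ 2)
    (hsmall : 16 * (α₂ * ((L : ℝ) ^ j * η)⁻¹ * η) ≤ 1)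
    (hd : 5 * (α₂ * ((L : ℝ) ^ j * η)⁻¹ * η) * ((d : ℝ) - 1) ≤ 4) :
    ‖covDiv η (mulCfg (expCfg (iEta η A)) U₀) μ x - covDiv η U₀ μ x -
        ((Complex.I : ℂ) * η ^ 2) • pdiv η U₀ (plaqCovDeriv η U₀ A) μ x‖ ≤
      36 * d * (α₂ * ((L : ℝ) ^ j * η)⁻¹) * G * η ^ 2 + 50 * d * α₂ ^ 3 * (((L : ℝ) ^ j * η)⁻¹) ^ 3 * η ^ 2 +
        10 * d * α₀ * α₂ * (((L : ℝ) ^ j * η)⁻¹) ^ 3 * η ^ 2 := by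
  set r : ℝ := ((L : ℝ) ^ j * η)⁻¹
  set U₁ := expCfg (iEta η A)
  have hr : 0 ≤ r := inv_nonneg.mpr (by positivity)
  have hd1 : (1 : ℝ) ≤ d := Nat.one_le_cast.mpr (Fin.pos μ)
  have h4 : 4 * (α₂ * r * η) ≤ 1 := by linarith [hsmall, show 0 ≤ α₂ * r * η by positivity]
  -- the exponent field `B = iηA`: `|B| ≤ ηα₂r`, `|∇B| ≤ ηG` on the neighbourhood of the bond
  have hB : ∀ y κ, BondNear μ x y κ → ‖iEta η A y κ‖ ≤ η * (α₂ * r) := fun y κ hn => by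
    rw [norm_iEta_apply hη.le]
    exact mul_le_mul_of_nonneg_left (hA y κ hn) hη.le
  have hB' : ∀ y κ, BondNear μ x y κ → ‖iEta η A y κ‖ ≤ η * α₂ * r := fun y κ hn =>
    (hB y κ hn).trans_eq (by ring)
  have hGB : ∀ (y : Site d) (κ τ : Fin d), BondNear μ x y τ →
      ‖covDerivFwd η U₀ κ (fun z => iEta η A z τ) y‖ ≤ η * G := by
    intro y κ τ hn
    have hf : (fun z => iEta η A z τ) = ((Complex.I : ℂ) * η) • fun z => A z τ := by
      funext z
      simp only [iEta, Pi.smul_apply]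
    rw [hf, covDerivFwd_smul, norm_I_eta_smul hη.le]
    exact mul_le_mul_of_nonneg_left (hG y κ τ hn) hη.le
  -- the five pieces
  set T0 := covDiv η (mulCfg U₁ U₀) μ x
  set T1 := covDiv η U₀ μ x
  set W := pdiv η (mulCfg U₁ U₀) (covPlaqF U₀ U₁) μ x
  set Y := pdiv η U₀ (covPlaqF U₀ U₁ - 1) μ x
  set M := ((η : ℂ) ^ 2) • ∑ ν ∈ Finset.univ.erase μ,
    conjR (U₀ (x - e ν) ν)⁻¹ (adR (-A (x - e ν) ν) (plaqCovDeriv η U₀ A μ ν (x - e ν)))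
  set P := ((Complex.I : ℂ) * η ^ 2) • pdiv η U₀ (plaqCovDeriv η U₀ A) μ x
  set V := ((η : ℂ) ^ 2 / 2) • pdiv η U₀ (V2 U₀ A) μ x
  have e144 : ‖T0 - T1 - W‖ ≤ 10 * d * α₀ * α₂ * r ^ 3 * η ^ 2 := eq144_printed_loc hη h₀ h₁ hα₀ hα₂ hu hp
  -- (1.46) in print's units, localised
  have e146 : ‖W - Y - M‖ ≤ 28 * d * α₂ ^ 3 * r ^ 3 * η ^ 2 := by
    have ha : 0 ≤ η * α₂ * r := by positivity
    have h16 : 16 * (η * α₂ * r) ≤ 1 := by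
      linarith [hsmall, show 16 * (α₂ * r * η) = 16 * (η * α₂ * r) by ring]
    have h := eq146_loc hη h₀ hB'
    rw [main146_printed] at h
    refine h.trans ?_
    calc ((d : ℝ) - 1) * (η⁻¹ * phi146 (η * α₂ * r))
        ≤ ((d : ℝ) - 1) * (η⁻¹ * (28 * (η * α₂ * r) ^ 3)) := by
          have := phi146_le ha h16
          have hη' : 0 ≤ η⁻¹ := inv_nonneg.mpr hη.le
          have hd0 : 0 ≤ (d : ℝ) - 1 := by linarith
          exact mul_le_mul_of_nonneg_left (mul_le_mul_of_nonneg_left this hη') hd0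
      _ = 28 * ((d : ℝ) - 1) * (η⁻¹ * (η * α₂ * r) ^ 3) := by ring
      _ ≤ 28 * d * α₂ ^ 3 * r ^ 3 * η ^ 2 := units146 (by norm_num) hη (mul_nonneg hα₂ hr) d
  -- (1.48) in print's units, localised
  have e148 : ‖Y - P + V‖ ≤ 4 ^ 3 / 3 * d * α₂ ^ 3 * r ^ 3 * η ^ 2 := by
    have ha : 0 ≤ η * α₂ * r := by positivity
    have h4' : 4 * (η * α₂ * r) ≤ 1 := by linarith [h4, show 4 * (α₂ * r * η) = 4 * (η * α₂ * r) by ring]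
    have h := eq148_loc hη h₀ hB'
    obtain ⟨hlin, hquad⟩ := lin_quad_iEta hη.ne' U₀ A
    rw [hlin, hquad, pdiv_smul, pdiv_smul, neg_div, neg_smul, sub_neg_eq_add] at h
    refine h.trans ?_
    have hρ := expRem3_le_taylor4 (by positivity : 0 ≤ 4 * (η * α₂ * r)) h4'
    have hc : 0 ≤ 2 * ((d : ℝ) - 1) * η⁻¹ :=
      mul_nonneg (mul_nonneg zero_le_two (by linarith)) (inv_nonneg.mpr hη.le)
    have hu' : α₂ ^ 3 * r ^ 3 * η ^ 2 = η⁻¹ * (η * α₂ * r) ^ 3 := by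
      rw [show (η * α₂ * r) ^ 3 = η * (η ^ 2 * (α₂ ^ 3 * r ^ 3)) by ring, ← mul_assoc, inv_mul_cancel₀ hη.ne',
        one_mul]
      ring
    have hα : 0 ≤ α₂ ^ 3 * r ^ 3 * η ^ 2 := by positivity
    have ha' : 0 ≤ α₂ * r * η := by positivity
    have key : ((d : ℝ) - 1) * (1 + 5 / 4 * (α₂ * r * η)) ≤ d := by nlinarith
    calc 2 * ((d : ℝ) - 1) * η⁻¹ * expRem3 (4 * (η * α₂ * r))
        ≤ 2 * ((d : ℝ) - 1) * η⁻¹ * ((4 * (η * α₂ * r)) ^ 3 / 6 * (1 + 5 / 16 * (4 * (η * α₂ * r)))) :=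
          mul_le_mul_of_nonneg_left hρ hc
      _ = 4 ^ 3 / 3 * (((d : ℝ) - 1) * (1 + 5 / 4 * (α₂ * r * η))) * (α₂ ^ 3 * r ^ 3 * η ^ 2) := by
          rw [hu']; ring
      _ ≤ 4 ^ 3 / 3 * (d : ℝ) * (α₂ ^ 3 * r ^ 3 * η ^ 2) := by gcongr
      _ = 4 ^ 3 / 3 * d * α₂ ^ 3 * r ^ 3 * η ^ 2 := by ring
  have e153 : ‖V‖ ≤ 32 * d * (α₂ * r) * G * η ^ 2 :=
    eq153_printed_loc hη h₀ (mul_nonneg hα₂ hr) hG0 hA hG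
  have eM : ‖M‖ ≤ 4 * d * (α₂ * r) * G * η ^ 2 := by
    have h := norm_main146_le_loc hη h₀ hB hGB
    rw [main146_printed] at h
    refine h.trans ?_
    have : 0 ≤ α₂ * r * G * η ^ 2 := by positivity
    nlinarith
  have heq : T0 - T1 - P = (T0 - T1 - W) + (W - Y - M) + (Y - P + V) - V + M := by abel
  rw [heq]
  have n1 := norm_add_le ((T0 - T1 - W) + (W - Y - M) + (Y - P + V) - V) M
  have n2 := norm_sub_le ((T0 - T1 - W) + (W - Y - M) + (Y - P + V)) V
  have n3 : ‖(T0 - T1 - W) + (W - Y - M) + (Y - P + V)‖ ≤ ‖T0 - T1 - W‖ + ‖W - Y - M‖ + ‖Y - P + V‖ :=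
    norm_add₃_le
  have hpos : 0 ≤ d * α₂ ^ 3 * r ^ 3 * η ^ 2 := by positivity
  nlinarith

end Eq154

#print axioms eq151_loc
#print axioms eq153_loc
#print axioms norm_main146_le_loc
#print axioms eq154_loc
#print axioms eq154_printed_loc

end Literature.MathematicalPhysics.QuantumFieldTheory.Balaban1983to89.B8Eq154Local

end
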